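import Summits.Ventures.LatticeQCDFlow.Exactness.HiddenSectorNoCertificate
import HarnessLib

/-!
# The certificate's oracle inputs cannot themselves be certified from the proposals: no honest lower bound on `c₁ = E_q[min(1, w)]`
# and no honest upper bound on the normaliser `Z = E_q[w̃]` — the hidden-sector world defeats both

HONEST FRAMING: exact (Metropolis-corrected) sampling algorithms for lattice gauge theory;
figures of merit are autocorrelation/cost numbers at stated couplings and volumes; no
continuum-physics claim.

Venture `LatticeQCDFlow` (cell pub-lqcd), topic `Exactness`; FANOUT row 30 (lean-1, GEN-41).  NEW WORK of the cell, sequel of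
GEN-41's `HiddenSectorNoCertificate` (setting and vocabulary there: a probability space `(E, P)` of raw randomness, `N` proposals
`Y_i` each with law `q`, PROCEDURES = functions of the randomness and of the target's unnormalised weight values at the proposals;
world 1 a weight `w̃ ≥ 0` with `Z₁ = E_q[w̃] > 0`, world 2 the hidden-sector weight `w̃ + L·1_H`, `q(H) > 0`, `L ≥ Z₁/(η·q(H))`).
The every-weight error bars of GEN-40 need a LOWER bound on `c₁ = E_q[min(1, w)]` (`w = w̃/Z` the normalised weight) and GEN-41's
`IMHCertificateCalibration` reduces every input to an UPPER bound on `Z`.  Here: neither can be read off the proposals.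

* §1 `measureReal_lt_lower_le_of_eqOn`, `measureReal_upper_lt_le_of_eqOn` — one-sided two-point lemmas: a lower-bound statistic
  honest in world 2 (`P(θ₂ < Lo) ≤ α₂`) satisfies `P(b < Lo) ≤ α₂ + P(Gᶜ)` in world 1 for every `b ≥ θ₂`; dually for upper bounds.
* §2 `hiddenSector_normaliser_ge` — `Z₂ = Z₁ + L·q(H) ≥ Z₁/η`; **`hiddenSector_meanMinOne_le`** — world 2's
  `c₁ = E_q[min(1, w̃₂/Z₂)] ≤ η + q(H)`: the hidden sector makes the normalised visible weights tiny.
* §3 **`hiddenSector_no_lower_certificate_c1`** — ANY lower-bound procedure for `c₁` that is honest in world 2 at level `α₂` reports,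
  in world 1, `Lo ≤ η + q(H)` with probability `≥ 1 − α₂ − N·q(H)` — WHATEVER world 1's true `c₁` (which is `≈ 1` for a flow that is
  perfect on the region it visits): the burn-in length of the certified bars cannot be certified from the run.
* §4 **`hiddenSector_no_upper_certificate_normaliser`** — ANY upper-bound procedure for `Z = E_q[w̃]` honest in world 2 reports, in
  world 1, `Up ≥ Z₁/η` with probability `≥ 1 − α₂ − N·q(H)`, for every `η > 0`: honest upper bounds on the normaliser (lower bounds on
  the free-energy difference) from proposals alone are unbounded — the one oracle input of `IMHCertificateCalibration` is a genuine one.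
Reading: together with `HiddenSectorNoCertificate` (no honest certificate for a sector weight) this closes the logic of the certified
error bars: exactness of the accept/reject step guarantees the right stationary law, never a printed guarantee from the run alone;
every honest finite-sample guarantee consumes one number about the target that the flow's samples cannot supply.  No `sorry`, no new
definitions, nothing cited as a fact.
-/

noncomputable section

namespace Summit.Ventures.LatticeQCDFlow.Exactness

open MeasureTheory Set
open scoped ENNReal

/-! ## §1 One-sided two-point lemmas -/

section OneSided

variable {E : Type*} [MeasurableSpace E] {P : Measure E} [IsFiniteMeasure P]

/-- **A lower bound honest in world 2 is small in world 1**: `Lo₁ = Lo₂` on `G`, `P(θ₂ < Lo₂) ≤ α₂`, `θ₂ ≤ b` ⇒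
`P(b < Lo₁) ≤ α₂ + P(Gᶜ)`. [ours] -/
theorem measureReal_lt_lower_le_of_eqOn {Lo₁ Lo₂ : E → ℝ} {G : Set E} (hLo : EqOn Lo₁ Lo₂ G) {θ₂ b α₂ : ℝ} (hb : θ₂ ≤ b)
    (hmiss₂ : P.real {e | θ₂ < Lo₂ e} ≤ α₂) : P.real {e | b < Lo₁ e} ≤ α₂ + P.real Gᶜ := by
  have hsub : {e | b < Lo₁ e} ⊆ {e | θ₂ < Lo₂ e} ∪ Gᶜ := fun e he => by
    by_cases heG : e ∈ G
    · left
      simp only [mem_setOf_eq] at he ⊢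
      rw [← hLo heG]; exact lt_of_le_of_lt hb he
    · exact Or.inr heG
  exact (measureReal_mono hsub).trans ((measureReal_union_le _ _).trans (by linarith))

/-- **An upper bound honest in world 2 is large in world 1**: `Up₁ = Up₂` on `G`, `P(Up₂ < θ₂) ≤ α₂`, `b ≤ θ₂` ⇒
`P(Up₁ < b) ≤ α₂ + P(Gᶜ)`. [ours] -/
theorem measureReal_upper_lt_le_of_eqOn {Up₁ Up₂ : E → ℝ} {G : Set E} (hUp : EqOn Up₁ Up₂ G) {θ₂ b α₂ : ℝ} (hb : b ≤ θ₂)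
    (hmiss₂ : P.real {e | Up₂ e < θ₂} ≤ α₂) : P.real {e | Up₁ e < b} ≤ α₂ + P.real Gᶜ := by
  have hsub : {e | Up₁ e < b} ⊆ {e | Up₂ e < θ₂} ∪ Gᶜ := fun e he => by
    by_cases heG : e ∈ G
    · left
      simp only [mem_setOf_eq] at he ⊢
      rw [← hUp heG]; exact lt_of_lt_of_le he hb
    · exact Or.inr heG
  exact (measureReal_mono hsub).trans ((measureReal_union_le _ _).trans (by linarith))

end OneSided

/-! ## §2 World 2's normaliser and mean min-one weight -/

section HiddenSector

variable {Ω : Type*} [MeasurableSpace Ω] {q : Measure Ω} [IsProbabilityMeasure q]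

/-- `Z₂ = Z₁ + L·q(H) ≥ Z₁/η` once `L ≥ Z₁/(η·q(H))` (`Z₁ ≥ 0`, `q(H) > 0`, `η > 0`). [ours, bookkeeping] -/
theorem hiddenSector_normaliser_ge {w : Ω → ℝ} (hw : Integrable w q) (hZ0 : 0 ≤ ∫ y, w y ∂q) {H : Set Ω} (hH : MeasurableSet H)
    (hqH : 0 < q.real H) {η : ℝ} (hη : 0 < η) {L : ℝ} (hL : (∫ y, w y ∂q) / (η * q.real H) ≤ L) :
    (∫ y, w y ∂q) / η ≤ ∫ y, (w y + H.indicator (fun _ => L) y) ∂q := by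
  rw [hiddenSector_integral hw L hH]
  have h1 : (∫ y, w y ∂q) / η ≤ L * q.real H := by
    rw [div_le_iff₀ hη]
    have := (div_le_iff₀ (mul_pos hη hqH)).1 hL
    nlinarith
  linarith

/-- **World 2's `c₁` is at most `η + q(H)`**: `E_q[min(1, w̃₂/Z₂)] ≤ η + q(H)` for `w̃₂ = w̃ + L·1_H`, `Z₂ = E_q[w̃₂]`, `w̃ ≥ 0` with
`Z₁ > 0`, `L ≥ Z₁/(η·q(H))` (on `H` the integrand is `≤ 1`, off `H` it is `≤ w̃/Z₂` and `Z₁/Z₂ ≤ η`). [ours] -/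
theorem hiddenSector_meanMinOne_le {w : Ω → ℝ} (hw : Integrable w q) (hw0 : ∀ y, 0 ≤ w y) (hZ : 0 < ∫ y, w y ∂q) {H : Set Ω}
    (hH : MeasurableSet H) (hqH : 0 < q.real H) {η : ℝ} (hη : 0 < η) {L : ℝ} (hL : (∫ y, w y ∂q) / (η * q.real H) ≤ L) :
    ∫ y, min 1 ((w y + H.indicator (fun _ => L) y) / ∫ z, (w z + H.indicator (fun _ => L) z) ∂q) ∂q ≤ η + q.real H := by
  set Z₁ := ∫ y, w y ∂q with hZ₁
  set Z₂ := ∫ z, (w z + H.indicator (fun _ => L) z) ∂q with hZ₂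
  have hLpos : 0 < L := lt_of_lt_of_le (by positivity) hL
  have hZ₂ge : Z₁ / η ≤ Z₂ := hiddenSector_normaliser_ge hw hZ.le hH hqH hη hL
  have hZ₂pos : 0 < Z₂ := lt_of_lt_of_le (by positivity) hZ₂ge
  -- pointwise: `min(1, w̃₂/Z₂) ≤ 1_H + w̃/Z₂`
  have hpt : ∀ y, min 1 ((w y + H.indicator (fun _ => L) y) / Z₂) ≤ H.indicator (fun _ => (1 : ℝ)) y + w y / Z₂ := by
    intro y
    by_cases hy : y ∈ H
    · rw [indicator_of_mem hy, indicator_of_mem hy]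
      exact (min_le_left _ _).trans (by have := div_nonneg (hw0 y) hZ₂pos.le; linarith)
    · rw [indicator_of_notMem hy, indicator_of_notMem hy, add_zero, zero_add]
      exact min_le_right _ _
  have hint_rhs : Integrable (fun y => H.indicator (fun _ => (1 : ℝ)) y + w y / Z₂) q :=
    ((integrable_const (1 : ℝ)).indicator hH).add (hw.div_const Z₂)
  have h0 : ∀ y, 0 ≤ min 1 ((w y + H.indicator (fun _ => L) y) / Z₂) := fun y =>
    le_min zero_le_one (div_nonneg (add_nonneg (hw0 y) (indicator_nonneg (fun _ _ => hLpos.le) y)) hZ₂pos.le)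
  calc ∫ y, min 1 ((w y + H.indicator (fun _ => L) y) / Z₂) ∂q
      ≤ ∫ y, (H.indicator (fun _ => (1 : ℝ)) y + w y / Z₂) ∂q :=
        integral_mono_of_nonneg (ae_of_all _ h0) hint_rhs (ae_of_all _ hpt)
    _ = q.real H + Z₁ / Z₂ := by
        rw [integral_add ((integrable_const (1 : ℝ)).indicator hH) (hw.div_const Z₂), integral_indicator_const _ hH,
          smul_eq_mul, mul_one, integral_div]
    _ ≤ q.real H + η := by
        gcongr
        rw [div_le_iff₀ hZ₂pos]
        rw [div_le_iff₀ hη] at hZ₂ge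
        linarith
    _ = η + q.real H := add_comm _ _

/-! ## §3 No honest lower certificate for `c₁` -/

/-- **THE BURN-IN INPUT `c₁` CANNOT BE CERTIFIED FROM THE PROPOSALS.**  `(E, P)` a probability space, `N` proposals each with law
`q`, world 1's weight `w̃ ≥ 0` integrable with `Z₁ > 0`, a measurable sector `H` with `q(H) > 0`, `η > 0`, `L ≥ Z₁/(η·q(H))`; a
lower-bound procedure `Lo` for the mean min-one normalised weight `c₁ = E_q[min(1, w̃/Z)]` that is honest in world 2
(`P(c₁(world 2) < Lo(world-2 data)) ≤ α₂`).  THEN in world 1, `P(η + q(H) < Lo(world-1 data)) ≤ α₂ + N·q(H)` — the certified lower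
bound is useless whatever world 1's true `c₁`. [ours] -/
theorem hiddenSector_no_lower_certificate_c1 {E : Type*} [MeasurableSpace E] {P : Measure E} [IsProbabilityMeasure P] {N : ℕ}
    {Y : E → Fin N → Ω} (hYm : ∀ i, Measurable fun e => Y e i) (hY : ∀ i, P.map (fun e => Y e i) = q)
    {w : Ω → ℝ} (hw : Integrable w q) (hw0 : ∀ y, 0 ≤ w y) (hZ : 0 < ∫ y, w y ∂q) {H : Set Ω} (hH : MeasurableSet H)
    (hqH : 0 < q.real H) {η : ℝ} (hη : 0 < η) {L : ℝ} (hL : (∫ y, w y ∂q) / (η * q.real H) ≤ L)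
    (Lo : E → (Fin N → ℝ) → ℝ) {α₂ : ℝ}
    (hmiss₂ : P.real {e | ∫ y, min 1 ((w y + H.indicator (fun _ => L) y) / ∫ z, (w z + H.indicator (fun _ => L) z) ∂q) ∂q <
        Lo e (fun i => w (Y e i) + H.indicator (fun _ => L) (Y e i))} ≤ α₂) :
    P.real {e | η + q.real H < Lo e (fun i => w (Y e i))} ≤ α₂ + N * q.real H := by
  have h := measureReal_lt_lower_le_of_eqOn (P := P) (eqOn_proc_of_eqOn_weights (Y := Y) Lo (hiddenSector_eqOn w L H))
    (hiddenSector_meanMinOne_le hw hw0 hZ hH hqH hη hL) hmiss₂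
  rw [compl_setOf_forall_mem] at h
  refine h.trans ?_
  have := measureReal_exists_not_mem_le (P := P) q hYm hY hH.compl
  rw [compl_compl] at this
  linarith

/-! ## §4 No honest upper certificate for the normaliser -/

/-- **THE NORMALISER CANNOT BE CERTIFIED FROM ABOVE.**  Same data model; an upper-bound procedure `Up` for `Z = E_q[w̃]` honest in
world 2 (`P(Up(world-2 data) < Z₂) ≤ α₂`).  THEN in world 1, for every `η > 0` (world 2 built with `L ≥ Z₁/(η·q(H))`),
`P(Up(world-1 data) < Z₁/η) ≤ α₂ + N·q(H)`: an honest upper bound on the normaliser exceeds any multiple of the truth. [ours] -/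
theorem hiddenSector_no_upper_certificate_normaliser {E : Type*} [MeasurableSpace E] {P : Measure E} [IsProbabilityMeasure P]
    {N : ℕ} {Y : E → Fin N → Ω} (hYm : ∀ i, Measurable fun e => Y e i) (hY : ∀ i, P.map (fun e => Y e i) = q)
    {w : Ω → ℝ} (hw : Integrable w q) (hw0 : ∀ y, 0 ≤ w y) {H : Set Ω} (hH : MeasurableSet H)
    (hqH : 0 < q.real H) {η : ℝ} (hη : 0 < η) {L : ℝ} (hL : (∫ y, w y ∂q) / (η * q.real H) ≤ L)
    (Up : E → (Fin N → ℝ) → ℝ) {α₂ : ℝ}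
    (hmiss₂ : P.real {e | Up e (fun i => w (Y e i) + H.indicator (fun _ => L) (Y e i)) <
        ∫ z, (w z + H.indicator (fun _ => L) z) ∂q} ≤ α₂) :
    P.real {e | Up e (fun i => w (Y e i)) < (∫ y, w y ∂q) / η} ≤ α₂ + N * q.real H := by
  have hZ0 : 0 ≤ ∫ y, w y ∂q := integral_nonneg fun y => hw0 y
  have h := measureReal_upper_lt_le_of_eqOn (P := P) (eqOn_proc_of_eqOn_weights (Y := Y) Up (hiddenSector_eqOn w L H))
    (hiddenSector_normaliser_ge hw hZ0 hH hqH hη hL) hmiss₂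
  rw [compl_setOf_forall_mem] at h
  refine h.trans ?_
  have := measureReal_exists_not_mem_le (P := P) q hYm hY hH.compl
  rw [compl_compl] at this
  linarith

end HiddenSector

end Summit.Ventures.LatticeQCDFlow.Exactness
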